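import Summits.CriticalPhenomena.PercolationContinuityZ3.Theorems.SahiMasterFamilyResidualStep

/-!
# The zero locus of `E_n` with at most TWO non-cylinder slots, every `n`, UNCONDITIONALLY — the equality-case companion of
# Blinovsky's two-free-slot theorem

Companion of `SahiMasterFamilyPrincipalDomination.lean` (crux `NoHeavyLowerTail`, stmt-CriticalPhenomena-4575; cell `prim-masterthm`, unit
`prim-masterthm-p4`).  Vocabulary: `SahiMasterFamily.lean` (`sahiE` = Sahi's `E_n` [Sahi2008; LiebSahi2021, Def. 3.1], `bernoulliWeight p`,
`ind`, the zero-flag class `Z_n = SuppZeroFlag n`).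

THE THEOREM (`sahiE_ind_eq_zero_iff_offTwo`, every `n`, NO hypothesis on Sahi's conjecture): for a product measure `μ_p` with `p` in the
open cube and a family of `n + 2` increasing events ALL BUT AT MOST TWO of which are cylinders `{ω | S_j ⊆ ω}` ("all coordinates of `S_j`
open"),
    `E_{n+2}(μ_p; 1_{U_0},…,1_{U_{n+1}}) = 0  ↔  U ∈ Z_{n+2}`.
Positivity on this class is Blinovsky's theorem with two free slots ([Blinovsky2013]; tree
`Literature.Combinatorics.Sahi2008.sahiE_bernoulliWeight_ind_nonneg_offTwo`); the zero locus is NEW and rests on the principal-slot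
DOMINATION inequality (`SahiMasterFamilyChangeWeightBound.sahiE_cons_setInd_ge_erase`): the class is closed under deleting a slot and
under `U_l ↦ U_l ∩ U_m` (a cylinder meets a cylinder in a cylinder), every member family with `≥ 3` events contains a cylinder, so
heredity of zeros (domination at a slot correlated with the cylinder, independent splitting otherwise) and the peeled step run inside
the class by induction on `n`, with base `n + 2 = 2` = strict Harris (`masterFamilyEqIff_two`).
Local-hypothesis forms of domination / heredity used by the induction: `sahiE_ind_cylinder_ge_erase_of_pos`,
`sahiE_ind_cylinder_heredity_of_pos(')`.  Special cases: `E_3(P, A, B)`, `E_4(P, P', A, B)` (`sahiE_four_ind_eq_zero_iff_of_two_cylinders`).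
GENERAL `K` (`sahiE_ind_eq_zero_iff_offK`): GIVEN `MasterFamilyEqIff j` for `j ≤ K`, the zero locus holds at every order for families
with at most `K` non-cylinder slots — the padded EQUALITY hierarchy collapses to its first `K` levels, exactly as the positivity
hierarchy does (tree `forall_sahiPositive_bernoulliWeight_iff_forall_offK`); `K = 3`: `sahiE_ind_eq_zero_iff_offThree`;
the equivalence `forall_masterFamilyEqIff_iff_forall_offK`. [this work]
-/

set_option autoImplicit false

open Finset
open scoped Classical

namespace Summit.CriticalPhenomena.PercolationContinuityZ3.Theorems

open Literature.Combinatorics.Sahi2008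
open MeasureTheory Function
open Literature.Probability.LatticeModels (principalUp mem_principalUp prodBernoulli)
open Literature.Probability.Percolation (DeterminedBy)
open Literature.Probability.Percolation.DecisionTree (ind ind_of_mem ind_of_not_mem ind_nonneg)

variable {ι : Type} [Fintype ι]

/-! ### Domination and heredity with local positivity hypotheses -/

/-- **Principal-slot domination, local form**: as `sahiE_ind_cylinder_ge_erase`, but assuming only the positivity of the Sahi
functionals of the sub-families of `U` under the frozen weight `p'` (instead of `MasterFamilyNonneg (k+1)`). [this work] -/
theorem sahiE_ind_cylinder_ge_erase_of_pos {k : ℕ} (p : ι → unitInterval) (S : Set ι) (U : Fin (k + 1) → Set (Set ι))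
    (hU : ∀ j, IsUpperSet (U j))
    (hpos : ∀ (j : ℕ) (e : Fin j ↪ Fin (k + 1)),
      0 ≤ sahiE (bernoulliWeight fun e => if e ∈ S then 1 else p e) j (fun l => ind (U (e l))))
    (i : Fin (k + 1)) :
    (ex (bernoulliWeight fun e => if e ∈ S then 1 else p e) (ind (U i)) - ex (bernoulliWeight p) (ind (U i))) *
        sahiE (bernoulliWeight p) (k + 1)
          (Matrix.vecCons (ind {ω : Set ι | S ⊆ ω}) fun l => ind (U (i.succAbove l))) ≤
      sahiE (bernoulliWeight p) (k + 2) (Matrix.vecCons (ind {ω : Set ι | S ⊆ ω}) fun l => ind (U l)) := by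
  set p' : ι → unitInterval := fun e => if e ∈ S then 1 else p e with hp'_def
  set m : ℝ := ∏ e, if e ∈ S then (p e : ℝ) else 1 with hm_def
  have hm0 : 0 ≤ m := Finset.prod_nonneg fun e _ => by
    split_ifs
    · exact (p e).2.1
    · exact zero_le_one
  have hμ' : ∀ ω, m * bernoulliWeight p' ω = if ω ∈ principalUp S then bernoulliWeight p ω else 0 :=
    fun ω => freeze_mul_bernoulliWeight_eq p S ω
  rw [← setInd_principalUp_eq_ind S]
  rcases hm0.eq_or_lt with hm | hm
  · have hnull : ∀ ω ∈ principalUp S, bernoulliWeight p ω = 0 := fun ω hω => by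
      have h := hμ' ω
      rw [if_pos hω, ← hm, zero_mul] at h
      exact h.symm
    rw [sahiE_cons_setInd_eq_zero_of_null _ (sum_bernoulliWeight p) _ hnull,
      sahiE_cons_setInd_eq_zero_of_null _ (sum_bernoulliWeight p) _ hnull, mul_zero]
  · have H : ∀ ρ : Finset (Fin (k + 1)),
        0 ≤ ∑ ω, (bernoulliWeight p' ω - bernoulliWeight p ω) * ∏ i ∈ ρ, ind (U i) ω :=
      fun ρ => sum_freeze_sub_mul_prod_ind_nonneg p S hm hU ρ
    have hq : ∀ (j : ℕ) (e : Fin j ↪ Fin (k + 1)),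
        0 ≤ sahiE (bernoulliWeight p') (j + 1) (Matrix.vecCons 1 fun l => ind (U (e l))) := by
      intro j e
      cases j with
      | zero =>
        rw [sahiE_one_apply, Matrix.cons_val_zero, ex_one (sum_bernoulliWeight p')]
        exact zero_le_one
      | succ j =>
        rw [sahiE_one_cons (sum_bernoulliWeight p')]
        exact mul_nonneg (Nat.cast_nonneg _) (hpos (j + 1) e)
    have hδ : ∑ ω, (bernoulliWeight p' ω - bernoulliWeight p ω) * ind (U i) ω =
        ex (bernoulliWeight p') (ind (U i)) - ex (bernoulliWeight p) (ind (U i)) := by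
      rw [ex, ex, ← Finset.sum_sub_distrib]
      exact Finset.sum_congr rfl fun ω _ => by ring
    have h := sahiE_cons_setInd_ge_erase (bernoulliWeight p) (sum_bernoulliWeight p) (bernoulliWeight p')
      (sum_bernoulliWeight p') (principalUp S) m hm.le hμ' (fun l => ind (U l)) H hq i
    rwa [hδ] at h

/-- **Heredity on the principal stratum, local form (cylinder in slot `0`)**: for `p` interior, `U_0 = {ω | S ⊆ ω}`, assuming
positivity of the sub-families of `(U_1,…,U_{k+2})` under the frozen weight and of the deleted families `U_{−(i+1)}` under `μ_p`:
`E_{k+3}(μ_p; 1_U) = 0 ⇒ ∃ m, E_{k+2}(μ_p; 1_{U_{−m}}) = 0`. [this work] -/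
theorem sahiE_ind_cylinder_heredity_of_pos {k : ℕ} (p : ι → unitInterval) (hp : ∀ e, (p e : ℝ) ∈ Set.Ioo (0 : ℝ) 1)
    (S : Set ι) (U : Fin (k + 3) → Set (Set ι)) (hU0 : U 0 = {ω : Set ι | S ⊆ ω}) (hU : ∀ j, IsUpperSet (U j))
    (hpos : ∀ (j : ℕ) (e : Fin j ↪ Fin (k + 2)),
      0 ≤ sahiE (bernoulliWeight fun e => if e ∈ S then 1 else p e) j (fun l => ind (U (e l).succ)))
    (hdel : ∀ i : Fin (k + 2), 0 ≤ sahiE (bernoulliWeight p) (k + 2) (fun j => ind (U (i.succ.succAbove j))))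
    (h0 : sahiE (bernoulliWeight p) (k + 3) (fun j => ind (U j)) = 0) :
    ∃ m : Fin (k + 3), sahiE (bernoulliWeight p) (k + 2) (fun j => ind (U (m.succAbove j))) = 0 := by
  set p' : ι → unitInterval := fun e => if e ∈ S then 1 else p e with hp'_def
  have hm : 0 < ∏ e, if e ∈ S then (p e : ℝ) else 1 :=
    Finset.prod_pos fun e _ => by
      split_ifs
      · exact (hp e).1
      · exact zero_lt_one
  by_cases hex : ∃ i : Fin (k + 2),
      ex (bernoulliWeight p') (ind (U i.succ)) - ex (bernoulliWeight p) (ind (U i.succ)) ≠ 0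
  · obtain ⟨i, hi⟩ := hex
    have hδ0 : 0 ≤ ex (bernoulliWeight p') (ind (U i.succ)) - ex (bernoulliWeight p) (ind (U i.succ)) := by
      have h := sum_freeze_sub_mul_prod_ind_nonneg p S hm (U := fun l : Fin (k + 2) => U l.succ)
        (fun l => hU _) {i}
      rw [ex, ex, ← Finset.sum_sub_distrib]
      refine le_of_le_of_eq h (Finset.sum_congr rfl fun ω _ => ?_)
      rw [Finset.prod_singleton]; ring
    have hδ : 0 < ex (bernoulliWeight p') (ind (U i.succ)) - ex (bernoulliWeight p) (ind (U i.succ)) :=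
      lt_of_le_of_ne hδ0 (Ne.symm hi)
    have hdom := sahiE_ind_cylinder_ge_erase_of_pos p S (fun l : Fin (k + 2) => U l.succ) (fun l => hU _) hpos i
    rw [← hU0, ← ind_family_eq_vecCons U, h0, ← ind_family_succAbove_succ_eq_vecCons U i] at hdom
    exact ⟨i.succ, le_antisymm (le_of_mul_le_mul_left (by rw [mul_zero]; exact hdom) hδ) (hdel i)⟩
  · push Not at hex
    set F : Finset ι := univ.filter (· ∈ S) with hF_def
    have hF : (↑F : Set ι) = S := by ext e; simp [hF_def]
    have hdet : ∀ l : Fin (k + 2), DeterminedBy (U l.succ) (↑F : Set ι)ᶜ := by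
      intro l
      have hind : ex (bernoulliWeight p) (ind (U l.succ) * ind {ω : Set ι | S ⊆ ω}) =
          ex (bernoulliWeight p) (ind (U l.succ)) * ex (bernoulliWeight p) (ind {ω : Set ι | S ⊆ ω}) := by
        rw [ex_ind_mul_ind_cylinder_eq, ex_ind_cylinder_eq_prod, sub_eq_zero.1 (hex l), mul_comm]
      obtain ⟨SA, T, hST, hSA, hT⟩ := disjoint_determinedBy_of_real_inter_eq p hp (hU l.succ)
        (isUpperSet_cylinder S) hind
      have hSsub : S ⊆ ↑T := subset_of_determinedBy_cylinder hT
      refine hSA.mono fun e he => ?_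
      rw [hF, Set.mem_compl_iff]
      intro heS
      exact Finset.disjoint_left.1 hST he (hSsub heS)
    have hsplit := sahiE_bernoulliWeight_ind_cons_eq_of_determinedBy p F
      (show DeterminedBy {ω : Set ι | S ⊆ ω} (↑F : Set ι) from hF ▸ determinedBy_cylinder S)
      (fun l : Fin (k + 2) => U l.succ) hdet
    rw [← hU0, ← ind_family_eq_vecCons U, h0] at hsplit
    have hPpos : 0 < (prodBernoulli p).real (U 0) := by
      rw [← ex_bernoulliWeight_ind, hU0]; exact ex_ind_cylinder_pos hp S
    have hk : (0 : ℝ) < (k + 1 : ℕ) := by positivity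
    refine ⟨0, ?_⟩
    have h := hsplit.symm
    rw [mul_eq_zero, mul_eq_zero] at h
    rcases h with (h | h) | h
    · exact absurd h hk.ne'
    · exact absurd h hPpos.ne'
    · simpa [Fin.succAbove_zero] using h

/-- **Heredity on the principal stratum, local form (cylinder in any slot)**: for `p` interior and `U_{m₀}` a cylinder, assuming
positivity of all injective sub-families of `U` under the frozen weight and of all deleted families under `μ_p`,
`E_{k+3}(μ_p; 1_U) = 0 ⇒ ∃ m, E_{k+2}(μ_p; 1_{U_{−m}}) = 0`. [this work] -/
theorem sahiE_ind_cylinder_heredity_of_pos' {k : ℕ} (p : ι → unitInterval) (hp : ∀ e, (p e : ℝ) ∈ Set.Ioo (0 : ℝ) 1)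
    (U : Fin (k + 3) → Set (Set ι)) (hU : ∀ j, IsUpperSet (U j)) (m₀ : Fin (k + 3)) (S : Set ι)
    (hm₀ : U m₀ = {ω : Set ι | S ⊆ ω})
    (hpos : ∀ (j : ℕ) (g : Fin j → Fin (k + 3)), Function.Injective g →
      0 ≤ sahiE (bernoulliWeight fun e => if e ∈ S then 1 else p e) j (fun l => ind (U (g l))))
    (hdel : ∀ m : Fin (k + 3), 0 ≤ sahiE (bernoulliWeight p) (k + 2) (fun j => ind (U (m.succAbove j))))
    (h0 : sahiE (bernoulliWeight p) (k + 3) (fun j => ind (U j)) = 0) :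
    ∃ m : Fin (k + 3), sahiE (bernoulliWeight p) (k + 2) (fun j => ind (U (m.succAbove j))) = 0 := by
  set σ : Equiv.Perm (Fin (k + 3)) := Equiv.swap 0 m₀ with hσ_def
  have h0' : sahiE (bernoulliWeight p) (k + 3) (fun j => ind (U (σ j))) = 0 := by
    rw [sahiE_ind_comp_perm]; exact h0
  have hσ0 : U (σ 0) = {ω : Set ι | S ⊆ ω} := by
    rw [hσ_def, Equiv.swap_apply_left]; exact hm₀
  have hpos' : ∀ (j : ℕ) (e : Fin j ↪ Fin (k + 2)),
      0 ≤ sahiE (bernoulliWeight fun e => if e ∈ S then 1 else p e) j (fun l => ind (U (σ (e l).succ))) :=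
    fun j e => hpos j (fun l => σ (e l).succ) fun a b hab => e.injective (Fin.succ_injective _ (σ.injective hab))
  have hdel' : ∀ i : Fin (k + 2),
      0 ≤ sahiE (bernoulliWeight p) (k + 2) (fun j => ind (U (σ (i.succ.succAbove j)))) := by
    intro i
    obtain ⟨τ, hτ⟩ := exists_perm_succAbove_comp σ i.succ
    have e : (fun j => ind (U (σ (i.succ.succAbove j)))) = fun j => ind (U ((σ i.succ).succAbove (τ j))) := by
      funext j; rw [hτ j]
    rw [e, sahiE_ind_comp_perm (bernoulliWeight p) τ (fun j => U ((σ i.succ).succAbove j))]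
    exact hdel _
  obtain ⟨m', hm'⟩ := sahiE_ind_cylinder_heredity_of_pos p hp S (fun j => U (σ j)) hσ0 (fun j => hU _) hpos' hdel' h0'
  obtain ⟨τ, hτ⟩ := exists_perm_succAbove_comp σ m'
  refine ⟨σ m', ?_⟩
  have e : (fun j => ind (U (σ (m'.succAbove j)))) = fun j => ind (U ((σ m').succAbove (τ j))) := by
    funext j; rw [hτ j]
  rw [e, sahiE_ind_comp_perm (bernoulliWeight p) τ (fun j => U ((σ m').succAbove j))] at hm'
  exact hm'

/-! ### Families with at most two non-cylinder slots -/

omit [Fintype ι] in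
/-- Sub-families (along an injection) of a family with `≤ K` non-cylinder slots have `≤ K` non-cylinder slots. [folklore] -/
theorem offK_comp {K n j : ℕ} {U : Fin n → Set (Set ι)} {I : Finset (Fin n)} (hI : I.card ≤ K) {S : Fin n → Set ι}
    (hS : ∀ i, i ∉ I → U i = {ω : Set ι | S i ⊆ ω}) (g : Fin j → Fin n) (hg : Function.Injective g) :
    (univ.filter fun l => g l ∈ I).card ≤ K ∧
      ∀ l, l ∉ (univ.filter fun l => g l ∈ I) → U (g l) = {ω : Set ι | S (g l) ⊆ ω} := by
  refine ⟨le_trans ?_ hI, fun l hl => hS (g l) fun h => hl (Finset.mem_filter.2 ⟨Finset.mem_univ l, h⟩)⟩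
  exact Finset.card_le_card_of_injOn g (fun l hl => (Finset.mem_filter.1 (Finset.mem_coe.1 hl)).2)
    fun a _ b _ hab => hg hab

/-- Positivity on the class with at most `K` non-cylinder slots GIVEN `MasterFamilyNonneg K` (the tree's padding theorem
`sahiE_bernoulliWeight_ind_nonneg_offK`; unconditional for `K ≤ 2` = Blinovsky's two-free-slot theorem), in the form used here.
[cite: Blinovsky2013, eq. (ee3); Sahi2008, Thm. 2 (p. 211)] -/
theorem sahiE_ind_nonneg_offK_of_masterFamilyNonneg {K n : ℕ} (hN : MasterFamilyNonneg K) (p : ι → unitInterval)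
    (U : Fin n → Set (Set ι)) (hU : ∀ j, IsUpperSet (U j)) (I : Finset (Fin n)) (hI : I.card ≤ K) (S : Fin n → Set ι)
    (hS : ∀ i, i ∉ I → U i = {ω : Set ι | S i ⊆ ω}) : 0 ≤ sahiE (bernoulliWeight p) n (fun j => ind (U j)) :=
  sahiE_bernoulliWeight_ind_nonneg_offK K ((masterFamilyNonneg_iff_sahiPositive K).1 hN ι) p U I hI (fun i _ => hU i) S hS

omit [Fintype ι] in
/-- Two cylinders meet in a cylinder. [folklore] -/
theorem cylinder_inter_cylinder (S T : Set ι) :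
    ({ω : Set ι | S ⊆ ω} ∩ {ω : Set ι | T ⊆ ω} : Set (Set ι)) = {ω : Set ι | S ∪ T ⊆ ω} := by
  ext ω
  simp only [Set.mem_inter_iff, Set.mem_setOf_eq, Set.union_subset_iff]

/-- **The padded equality hierarchy collapses to its first `K` levels (every `n`).**  GIVEN `MasterFamilyEqIff j` for all `j ≤ K`
(theorems for `K ≤ 2`), for `p` in the open cube and `n + 2` increasing events all but at most `K` of which are cylinders
`{ω | S_i ⊆ ω}`: `E_{n+2}(μ_p; 1_{U_0},…,1_{U_{n+1}}) = 0 ↔ U ∈ Z_{n+2}`.  `K = 2`: `sahiE_ind_eq_zero_iff_offTwo`, unconditional.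
[this work] -/
theorem sahiE_ind_eq_zero_iff_offK (K : ℕ) (hEK : ∀ j, j ≤ K → MasterFamilyEqIff j) (p : ι → unitInterval)
    (hp : ∀ e, (p e : ℝ) ∈ Set.Ioo (0 : ℝ) 1) :
    ∀ (n : ℕ) (U : Fin (n + 2) → Set (Set ι)), (∀ j, IsUpperSet (U j)) →
      ∀ (I : Finset (Fin (n + 2))), I.card ≤ K → ∀ (S : Fin (n + 2) → Set ι),
        (∀ i, i ∉ I → U i = {ω : Set ι | S i ⊆ ω}) →
        (sahiE (bernoulliWeight p) (n + 2) (fun j => ind (U j)) = 0 ↔ SuppZeroFlag (n + 2) U)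
  | 0, U, hU, _, _, _, _ => masterFamilyEqIff_two ι p hp U hU
  | n + 1, U, hU, I, hI, S, hS => by
    have hN : MasterFamilyNonneg K := masterFamilyNonneg_of_masterFamilyEqIff (hEK K le_rfl)
    refine ⟨fun h0 => ?_, fun hZ => masterFamilyEqIff_mpr (n + 3) ι p U hZ⟩
    -- either every slot is free (then `n + 3 ≤ K` and (EQ-(n+3)) is a hypothesis), or a cylinder slot exists
    by_cases hall : ∀ m₀ : Fin (n + 3), m₀ ∈ I
    · have hle : n + 3 ≤ K := by
        have : (univ : Finset (Fin (n + 3))).card ≤ I.card := Finset.card_le_card fun x _ => hall x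
        rw [Finset.card_univ, Fintype.card_fin] at this
        omega
      exact (hEK (n + 3) hle ι p hp U hU).1 h0
    push Not at hall
    obtain ⟨m₀, hm₀I⟩ := hall
    have hpos : ∀ (j : ℕ) (g : Fin j → Fin (n + 3)), Function.Injective g →
        0 ≤ sahiE (bernoulliWeight fun e => if e ∈ S m₀ then 1 else p e) j (fun l => ind (U (g l))) := by
      intro j g hg
      obtain ⟨hI', hS'⟩ := offK_comp hI hS g hg
      exact sahiE_ind_nonneg_offK_of_masterFamilyNonneg hN _ (fun l => U (g l)) (fun l => hU _) _ hI' (fun l => S (g l)) hS'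
    have hdel : ∀ m : Fin (n + 3), 0 ≤ sahiE (bernoulliWeight p) (n + 2) (fun j => ind (U (m.succAbove j))) := by
      intro m
      obtain ⟨hI', hS'⟩ := offK_comp hI hS m.succAbove Fin.succAbove_right_injective
      exact sahiE_ind_nonneg_offK_of_masterFamilyNonneg hN p (fun l => U (m.succAbove l)) (fun l => hU _) _ hI'
        (fun l => S (m.succAbove l)) hS'
    obtain ⟨m, hm⟩ := sahiE_ind_cylinder_heredity_of_pos' p hp U hU m₀ (S m₀) (hS m₀ hm₀I) hpos hdel h0
    obtain ⟨hIm, hSm⟩ := offK_comp hI hS m.succAbove Fin.succAbove_right_injective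
    have hZ : SuppZeroFlag (n + 2) (fun j => U (m.succAbove j)) :=
      (sahiE_ind_eq_zero_iff_offK K hEK p hp n (fun j => U (m.succAbove j)) (fun j => hU _) _ hIm
        (fun l => S (m.succAbove l)) hSm).1 hm
    -- peeled step: every modified family is in the class, nonnegative, hence zero, hence a zero flag by induction
    refine ⟨m, hZ, fun l => ?_⟩
    set Im : Finset (Fin (n + 2)) := univ.filter fun j => m.succAbove j ∈ I with hIm_def
    set I' : Finset (Fin (n + 2)) := if m ∈ I then insert l Im else Im with hI'_def
    set S' : Fin (n + 2) → Set ι := fun j => if j = l then S (m.succAbove l) ∪ S m else S (m.succAbove j) with hS'_def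
    have hI'card : I'.card ≤ K := by
      rw [hI'_def]
      split_ifs with hmI
      · -- `m ∈ I`: the deleted family has at most `K - 1` non-cylinder slots
        have h1 : Im.card + 1 ≤ K := by
          have hsub : Im.card ≤ (I.erase m).card :=
            Finset.card_le_card_of_injOn m.succAbove
              (fun j hj => by
                have hj' := (Finset.mem_filter.1 (Finset.mem_coe.1 hj)).2
                exact Finset.mem_coe.2 (Finset.mem_erase.2 ⟨Fin.succAbove_ne m j, hj'⟩))
              fun a _ b _ hab => Fin.succAbove_right_injective hab
          rw [Finset.card_erase_of_mem hmI] at hsub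
          have := Finset.card_pos.2 ⟨m, hmI⟩
          omega
        exact (Finset.card_insert_le l Im).trans (by omega)
      · exact hIm
    have hS' : ∀ j, j ∉ I' →
        update (fun j => U (m.succAbove j)) l (U (m.succAbove l) ∩ U m) j = {ω : Set ι | S' j ⊆ ω} := by
      intro j hj
      by_cases hjl : j = l
      · subst hjl
        have hmI : m ∉ I := fun hmI => hj (by rw [hI'_def, if_pos hmI]; exact Finset.mem_insert_self _ _)
        have hjIm : j ∉ Im := fun h => hj (by rw [hI'_def, if_neg hmI]; exact h)
        have hjI : m.succAbove j ∉ I := fun h => hjIm (Finset.mem_filter.2 ⟨Finset.mem_univ _, h⟩)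
        rw [update_self, hS _ hjI, hS m hmI, cylinder_inter_cylinder, hS'_def]
        simp
      · have hjIm : j ∉ Im := by
          intro h
          apply hj
          rw [hI'_def]
          split_ifs
          · exact Finset.mem_insert_of_mem h
          · exact h
        have hjI : m.succAbove j ∉ I := fun h => hjIm (Finset.mem_filter.2 ⟨Finset.mem_univ _, h⟩)
        rw [update_of_ne hjl, hS _ hjI, hS'_def]
        simp [hjl]
    have hUmod : ∀ j, IsUpperSet (update (fun j => U (m.succAbove j)) l (U (m.succAbove l) ∩ U m) j) :=
      isUpperSet_update_inter hU m l
    -- the sum of the (nonnegative) modified functionals vanishes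
    have hstep := sahiE_ind_step p U m hZ
    rw [h0] at hstep
    have hterm : ∀ l' : Fin (n + 2), 0 ≤ sahiE (bernoulliWeight p) (n + 2)
        (fun j => ind (update (fun j => U (m.succAbove j)) l' (U (m.succAbove l') ∩ U m) j)) := by
      intro l'
      -- same class argument for `l'`
      set Il : Finset (Fin (n + 2)) := if m ∈ I then insert l' Im else Im with hIl_def
      have hIlcard : Il.card ≤ K := by
        rw [hIl_def]
        split_ifs with hmI
        · have h1 : Im.card + 1 ≤ K := by
            have hsub : Im.card ≤ (I.erase m).card :=
              Finset.card_le_card_of_injOn m.succAbove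
                (fun j hj => by
                  have hj' := (Finset.mem_filter.1 (Finset.mem_coe.1 hj)).2
                  exact Finset.mem_coe.2 (Finset.mem_erase.2 ⟨Fin.succAbove_ne m j, hj'⟩))
                fun a _ b _ hab => Fin.succAbove_right_injective hab
            rw [Finset.card_erase_of_mem hmI] at hsub
            have := Finset.card_pos.2 ⟨m, hmI⟩
            omega
          exact (Finset.card_insert_le l' Im).trans (by omega)
        · exact hIm
      refine sahiE_ind_nonneg_offK_of_masterFamilyNonneg hN p _ (isUpperSet_update_inter hU m l') Il hIlcard
        (fun j => if j = l' then S (m.succAbove l') ∪ S m else S (m.succAbove j)) fun j hj => ?_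
      by_cases hjl : j = l'
      · subst hjl
        have hmI : m ∉ I := fun hmI => hj (by rw [hIl_def, if_pos hmI]; exact Finset.mem_insert_self _ _)
        have hjIm : j ∉ Im := fun h => hj (by rw [hIl_def, if_neg hmI]; exact h)
        have hjI : m.succAbove j ∉ I := fun h => hjIm (Finset.mem_filter.2 ⟨Finset.mem_univ _, h⟩)
        rw [update_self, hS _ hjI, hS m hmI, cylinder_inter_cylinder]
        simp
      · have hjIm : j ∉ Im := by
          intro h
          apply hj
          rw [hIl_def]
          split_ifs
          · exact Finset.mem_insert_of_mem h
          · exact h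
        have hjI : m.succAbove j ∉ I := fun h => hjIm (Finset.mem_filter.2 ⟨Finset.mem_univ _, h⟩)
        rw [update_of_ne hjl, hS _ hjI]
        simp [hjl]
    have hzero := (Finset.sum_eq_zero_iff_of_nonneg fun l' _ => hterm l').1 hstep.symm l (Finset.mem_univ l)
    exact (sahiE_ind_eq_zero_iff_offK K hEK p hp n _ hUmod I' hI'card S' hS').1 hzero

/-- **The zero locus with at most two non-cylinder slots (every `n`, UNCONDITIONAL).**  For `p` in the open cube and `n + 2`
increasing events all but at most two of which are cylinders `{ω | S_i ⊆ ω}`: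
`E_{n+2}(μ_p; 1_{U_0},…,1_{U_{n+1}}) = 0 ↔ U ∈ Z_{n+2}`. [this work] -/
theorem sahiE_ind_eq_zero_iff_offTwo (p : ι → unitInterval) (hp : ∀ e, (p e : ℝ) ∈ Set.Ioo (0 : ℝ) 1) (n : ℕ)
    (U : Fin (n + 2) → Set (Set ι)) (hU : ∀ j, IsUpperSet (U j)) (I : Finset (Fin (n + 2))) (hI : I.card ≤ 2)
    (S : Fin (n + 2) → Set ι) (hS : ∀ i, i ∉ I → U i = {ω : Set ι | S i ⊆ ω}) :
    sahiE (bernoulliWeight p) (n + 2) (fun j => ind (U j)) = 0 ↔ SuppZeroFlag (n + 2) U :=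
  sahiE_ind_eq_zero_iff_offK 2 (fun _ hj => masterFamilyEqIff_of_le_two hj) p hp n U hU I hI S hS

/-- **At `K = 3`**: GIVEN `MasterFamilyEqIff 3` (which contains Kahn's Conjecture 5), the zero locus `E_n = 0 ↔ Z_n` holds at EVERY
order `n` for families with at most three non-cylinder slots. [this work] -/
theorem sahiE_ind_eq_zero_iff_offThree (hE : MasterFamilyEqIff 3) (p : ι → unitInterval)
    (hp : ∀ e, (p e : ℝ) ∈ Set.Ioo (0 : ℝ) 1) (n : ℕ) (U : Fin (n + 2) → Set (Set ι)) (hU : ∀ j, IsUpperSet (U j))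
    (I : Finset (Fin (n + 2))) (hI : I.card ≤ 3) (S : Fin (n + 2) → Set ι)
    (hS : ∀ i, i ∉ I → U i = {ω : Set ι | S i ⊆ ω}) :
    sahiE (bernoulliWeight p) (n + 2) (fun j => ind (U j)) = 0 ↔ SuppZeroFlag (n + 2) U := by
  refine sahiE_ind_eq_zero_iff_offK 3 (fun j hj => ?_) p hp n U hU I hI S hS
  rcases Nat.lt_or_ge j 3 with h | h
  · exact masterFamilyEqIff_of_le_two (by omega)
  · have : j = 3 := le_antisymm hj h
    rw [this]; exact hE



/-- **`E_4(μ_p; 1_P, 1_{P'}, 1_A, 1_B) = 0 ↔ Z_4`** for two cylinders `P, P'` and two arbitrary increasing events, `p` interior —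
unconditional (the positivity `E_4 ≥ 0` is the tree's `sahiE4_prodBernoulli_nonneg_of_cylinders`). [this work] -/
theorem sahiE_four_ind_eq_zero_iff_of_two_cylinders (p : ι → unitInterval) (hp : ∀ e, (p e : ℝ) ∈ Set.Ioo (0 : ℝ) 1)
    (S T : Set ι) (A B : Set (Set ι)) (hA : IsUpperSet A) (hB : IsUpperSet B) :
    sahiE (bernoulliWeight p) 4 (fun j => ind ((![{ω : Set ι | S ⊆ ω}, {ω : Set ι | T ⊆ ω}, A, B] : Fin 4 → Set (Set ι)) j)) = 0 ↔
      SuppZeroFlag 4 (![{ω : Set ι | S ⊆ ω}, {ω : Set ι | T ⊆ ω}, A, B] : Fin 4 → Set (Set ι)) := by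
  refine sahiE_ind_eq_zero_iff_offTwo p hp 2 _ (fun j => ?_) {2, 3} (by decide) ![S, T, ∅, ∅] (fun i hi => ?_)
  · fin_cases j
    · exact isUpperSet_cylinder S
    · exact isUpperSet_cylinder T
    · exact hA
    · exact hB
  · fin_cases i <;> simp_all

/-- **The padded equality hierarchy is EQUIVALENT to its first `K` levels**: `MasterFamilyEqIff j` for all `j ≤ K` iff the zero
locus `E_n = 0 ↔ Z_n` holds at every order `n` for increasing families with at most `K` non-cylinder slots (interior `p`) — the
equality-locus analogue of the tree's `forall_sahiPositive_bernoulliWeight_iff_forall_offK`. [this work] -/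
theorem forall_masterFamilyEqIff_iff_forall_offK (K : ℕ) :
    (∀ j, j ≤ K → MasterFamilyEqIff j) ↔
      ∀ (ι : Type) [Fintype ι] (p : ι → unitInterval), (∀ e, (p e : ℝ) ∈ Set.Ioo (0 : ℝ) 1) →
        ∀ (n : ℕ) (U : Fin n → Set (Set ι)), (∀ j, IsUpperSet (U j)) → ∀ I : Finset (Fin n), I.card ≤ K →
          ∀ S : Fin n → Set ι, (∀ i, i ∉ I → U i = {ω : Set ι | S i ⊆ ω}) →
            (sahiE (bernoulliWeight p) n (fun j => ind (U j)) = 0 ↔ SuppZeroFlag n U) := by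
  constructor
  · intro hEK ι _ p hp n U hU I hI S hS
    match n, U, hU, I, hI, S, hS with
    | 0, U, hU, _, _, _, _ => exact masterFamilyEqIff_zero ι p hp U hU
    | 1, U, hU, _, _, _, _ => exact masterFamilyEqIff_one ι p hp U hU
    | n + 2, U, hU, I, hI, S, hS => exact sahiE_ind_eq_zero_iff_offK K hEK p hp n U hU I hI S hS
  · intro h j hj ι _ p hp U hU
    exact h ι p hp j U hU univ (by rw [Finset.card_univ, Fintype.card_fin]; exact hj) (fun _ => ∅)
      fun i hi => (hi (Finset.mem_univ i)).elim

end Summit.CriticalPhenomena.PercolationContinuityZ3.Theorems
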